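import Literature.Computability.Cryptography.RegevSamplerRegs
import Literature.Algebra.EuclideanLattices.RegevBoxGaussianState
import Literature.Computability.QuantumComplexity.GRStagePlaced
import Literature.Computability.QuantumComplexity.Lemma24Main
import HarnessLib

/-!
# Regev 2009, Lemma 3.14 in machine form: the prepared label is the label of the Grover–Rudolph blocks

Topic `Computability/Cryptography` (family `pqc`), grouping namespace `Regev2009.SamplerRegs`; sequel of
`RegevSamplerRegs.lean` (the prepared label `lab₀ x` of a box point on the layout `Λ`: point bits on the
zone `X`, the query prefix on `U`, zeros elsewhere) and of
`Algebra/EuclideanLattices/RegevBoxGaussianState.lean` (Regev 2009, Lemma 3.12 in machine form: on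
pairwise disjoint coordinate blocks `E i : Fin B ↪ Fin W` the product of the one-dimensional point-Gaussian
states `ptQsample` is the box Gaussian `Z⁻¹ Σ_{x ∈ Box} ρ(x) |boxLab₀ x⟩`). Regev's sampler (J. ACM 56
(2009), art. 34; arXiv:2401.03703, Lemma 3.14 p. 20 with Lemma 3.12: "Repeating the procedure … `n` times
creates … the `n`-fold tensor product") prepares the Gaussian state coordinate by coordinate and THEN runs
the classical stage on the same registers; this file identifies the two register pictures:

* `BlocksFit` — the coordinate blocks FIT the layout: block `i`'s point wires are the layout's point-zone
  positions `i·ℓ + j`, every other block wire (work window, gadget kit, parameters) sits at or above the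
  base of the work window, and the blocks are pairwise disjoint;
* `stdBlock`, **`blocksFit_stdBlock`** — the CONSTRUCTION: given any block geometry `ws : Fin ℓ ↪ Fin B`
  and room `base + n·B ≤ W`, the blocks "point wire `j` ↦ position `i·ℓ + j`, other wire `q` ↦ wire
  `base + i·B + q`" fit the layout;
* `getD_pointsWord` — bit `i·ℓ + j` of the point register's content is `Y i j`;
* **`boxLab_eq_lab₀`** — with the block base content clean off the point wires, the block label of the
  contents `Y` over the background `lab₀ x'` IS the prepared label `lab₀ (boxPt D Y)`;
* **`prodState_ptQsample_eq_embed_lab₀`** — hence the product of the point-Gaussian block states over the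
  background `lab₀ x'` is the box Gaussian ON THE PREPARED LABELS, `embed Box (ρ/Z) lab₀` — the state
  `Φ₀` against which `QPart.law_bound_of_basis` measures the Grover–Rudolph stage (`ε₁`);
* `notLayer L` (a layer of `NOT`s, compiled Clifford+T), `flipOn`, `isBasisMap_notLayer`
  (`Lemma24.revEval_map_not`), **`flipOn_boxLab`** / `notLayer_mulVec_embed_boxLab₀` — ERASING THE BLOCK
  CONSTANTS: the Grover–Rudolph block runs on a base content `x₀` carrying its parameters and kit
  constants; the `NOT` layer on exactly those wires turns the block labels over `x₀` into the block labels
  over the clean content `x₁` (the classical stage of `RegevSamplerClassical.kappa_spec` wants a clean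
  work window);
* **`l2Norm_notLayer_grStage_sub_embed_le`** — THE GROVER–RUDOLPH STAGE BOUND `ε₁` of Lemma 3.14 for the
  prepared labels: from the clean label with the block constants in place, the stage circuit of
  `GRStagePlaced` followed by the erasing layer is within `n·(ℓ·grErr k + η)` of `embed Box (ρ/Z) lab₀`,
  `η` the one-block distance of the ideal Grover–Rudolph product to the point-Gaussian state
  (`GRStage.stage_output_sub_prodState_le`, the erasure is unitary); `…_of_qsample` — the same against
  the Gaussian qsample, `ε₁ ≤ n·(ℓ·grErr k + η_m + 2c(2·2^ℓ + 1))` (`GaussianCells.l2Norm_qsample_sub_ptQsample_le`);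
  `…_machine` — the explicit `ε₁` when the block's angles are the cosine machine's `A/2^{k_A}`
  (`GaussianCellsAngles.l2Norm_prod_machineBlock_sub_qsample_le`: `η_m ≤ ℓ√(2ε² + 8·2^ℓμ/W)`).

Everything is proved; `BlocksFit` is a structure of hypotheses, constructed by `blocksFit_stdBlock`; no named
fact is introduced.

## References

* O. Regev, *On lattices, learning with errors, random linear codes, and cryptography*, J. ACM 56
  (2009), art. 34; author's version arXiv:2401.03703: Lemma 3.14 (proof, p. 20), Lemma 3.12 (proof)
  [Regev2009].
* M. A. Nielsen, I. L. Chuang, *Quantum Computation and Quantum Information*, CUP 2010, §2.1.7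
  (tensor products of registers), §3.2.5 (reversible classical circuits), Box 4.1 [NielsenChuang2010].
* L. Grover, T. Rudolph, *Creating superpositions that correspond to efficiently integrable probability
  distributions*, arXiv:quant-ph/0208112 (2002) [GroverRudolph2002].
-/

noncomputable section

namespace Literature.Computability.Cryptography

namespace Regev2009

namespace SamplerRegs

open Literature.Algebra.EuclideanLattices Literature.Algebra.EuclideanLattices.Regev2009
  Literature.Algebra.EuclideanLattices.Regev2009.QPart Literature.Computability.QuantumComplexity
  Literature.Computability.QuantumComplexity.GaussianCells Literature.Computability.QuantumComplexity.GroverRudolph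
  Literature.Computability.QuantumComplexity.GRWord Finset _root_.Matrix SamplerGeom SamplerFormats SamplerClassical
  SamplerClassical.Layout
open scoped Real

variable {W B : ℕ} (I : LatticeInstance) {Λ : Layout W I.n} (hΛ : Λ.OK) (R : ℕ) (t : ℝ) (uz : List Bool)

/-- **The coordinate blocks fit the layout**: pairwise disjoint blocks `E i : Fin B ↪ Fin W` whose point
wires `ws` are the layout's point-zone positions `i·ℓ + j` and whose other wires lie at or above the base
of the work window. [cite: Regev2009, Lemma 3.14 (proof: the registers)] [cite: NielsenChuang2010, §2.1.7] -/
structure BlocksFit (Λ : Layout W I.n) (E : Fin I.n → (Fin B ↪ Fin W)) (ws : Fin Λ.ℓ ↪ Fin B) : Prop where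
  /-- the blocks are pairwise disjoint -/
  disj : BlockDisjoint E
  /-- the point wires of block `i` are the point-zone positions `i·ℓ + j` -/
  ws_eq : ∀ (i : Fin I.n) (j : Fin Λ.ℓ), E i (ws j) = Λ.fin ((i : ℕ) * Λ.ℓ + j)
  /-- every other block wire is in the work window -/
  off_ge : ∀ (i : Fin I.n) (q : Fin B), q ∉ Set.range ws → Λ.base ≤ (E i q : ℕ)

omit Λ in
/-- Bit `i·ℓ + j` of the point register's content is `Y i j`. [folklore] -/
theorem getD_pointsWord {n ℓ : ℕ} (Y : Fin n → Fin ℓ → Bool) (i : Fin n) (j : Fin ℓ) :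
    (pointsWord Y).getD ((i : ℕ) * ℓ + j) false = Y i j := by
  have hi : (i : ℕ) < (List.ofFn fun i => binVal (Y i)).length := by rw [List.length_ofFn]; exact i.2
  have h1 := drop_take_tableL ℓ (List.ofFn fun i => binVal (Y i)) hi
  rw [List.getElem_ofFn] at h1
  have h2 : (pointsWord Y)[(i : ℕ) * ℓ + (j : ℕ)]? = (bitsMSBL ℓ (binVal (Y i)))[(j : ℕ)]? := by
    rw [pointsWord_eq_tableL, ← h1, List.getElem?_take_of_lt j.2, List.getElem?_drop]
  rw [List.getD_eq_getElem?_getD, h2, bitsMSBL_binVal, List.getElem?_eq_getElem (by rw [List.length_ofFn]; exact j.2),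
    Option.getD_some, List.getElem_ofFn]

/-- Off the point zone the prepared label does not depend on the point. [folklore] -/
theorem lab₀_congr_off (x x' : EuclideanSpace ℝ (Fin I.n)) (w : Fin W) (hX : ∀ s, s < I.n * Λ.ℓ → w ≠ Λ.fin s) :
    lab₀ I Λ R t uz x w = lab₀ I Λ R t uz x' w := by
  unfold lab₀
  have h1 : ¬ ∃ s : Fin (I.n * Λ.ℓ), w = Λ.fin s := fun ⟨s, hs⟩ => hX s s.2 hs
  rw [dif_neg h1, dif_neg h1]

omit R t uz in
/-- Every point-zone position is a point wire of some block. [folklore] -/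
theorem exists_block_of_lt {E : Fin I.n → (Fin B ↪ Fin W)} {ws : Fin Λ.ℓ ↪ Fin B} (hE : BlocksFit I Λ E ws)
    {s : ℕ} (hs : s < I.n * Λ.ℓ) : ∃ (i : Fin I.n) (j : Fin Λ.ℓ), Λ.fin s = E i (ws j) := by
  have hℓ : 0 < Λ.ℓ := Nat.pos_of_ne_zero fun h => by rw [h, mul_zero] at hs; exact Nat.not_lt_zero _ hs
  refine ⟨⟨s / Λ.ℓ, (Nat.div_lt_iff_lt_mul hℓ).2 hs⟩, ⟨s % Λ.ℓ, Nat.mod_lt _ hℓ⟩, ?_⟩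
  rw [hE.ws_eq]
  congr 1
  exact (Nat.div_add_mod' s Λ.ℓ).symm

/-! ### The standard blocks -/

omit R t uz in
include hΛ in
/-- A point-zone position is a wire below the base. [folklore] -/
theorem fin_blk_lt_base (i : Fin I.n) (j : Fin Λ.ℓ) : (Λ.fin ((i : ℕ) * Λ.ℓ + j) : ℕ) < Λ.base := by
  have hT := Λ.T_eq
  have := blk_lt i j
  exact Layout.fin_lt_base hΛ (by omega)

/-- **The standard coordinate block `i`** for a block geometry with point wires `ws : Fin ℓ ↪ Fin B` and a
window starting at `base` with `base + n·B ≤ W`: point wire `j` goes to the layout's position `i·ℓ + j`,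
any other block wire `q` to the window wire `base + i·B + q`. [cite: Regev2009, Lemma 3.14 (proof: the registers)] [cite: NielsenChuang2010, §2.1.7] -/
def stdBlock (Λ : Layout W I.n) (hΛ : Λ.OK) (ws : Fin Λ.ℓ ↪ Fin B) (hroom : Λ.base + I.n * B ≤ W) (i : Fin I.n) : Fin B ↪ Fin W where
  toFun q := if h : ∃ j, ws j = q then Λ.fin ((i : ℕ) * Λ.ℓ + h.choose)
    else ⟨Λ.base + ((i : ℕ) * B + q), by have := blk_lt i q; omega⟩
  inj' q q' hqq := by
    by_cases h : ∃ j, ws j = q <;> by_cases h' : ∃ j, ws j = q'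
    · simp only [dif_pos h, dif_pos h'] at hqq
      have hT := Λ.T_eq
      have h1 := blk_lt i h.choose; have h2 := blk_lt i h'.choose
      have := Layout.fin_inj hΛ (by omega) (by omega) hqq
      rw [← h.choose_spec, ← h'.choose_spec, show h.choose = h'.choose from Fin.ext (by omega)]
    · simp only [dif_pos h, dif_neg h'] at hqq
      have := fin_blk_lt_base I hΛ i h.choose
      rw [hqq] at this
      exact absurd this (by simp)
    · simp only [dif_neg h, dif_pos h'] at hqq
      have := fin_blk_lt_base I hΛ i h'.choose
      rw [← hqq] at this
      exact absurd this (by simp)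
    · simp only [dif_neg h, dif_neg h', Fin.mk.injEq] at hqq
      exact Fin.ext (by omega)

omit R t uz in
/-- The standard block on a point wire. [folklore] -/
theorem stdBlock_ws (ws : Fin Λ.ℓ ↪ Fin B) (hroom : Λ.base + I.n * B ≤ W) (i : Fin I.n) (j : Fin Λ.ℓ) :
    stdBlock I Λ hΛ ws hroom i (ws j) = Λ.fin ((i : ℕ) * Λ.ℓ + j) := by
  have h : ∃ j', ws j' = ws j := ⟨j, rfl⟩
  show (if h : ∃ j', ws j' = ws j then Λ.fin ((i : ℕ) * Λ.ℓ + h.choose) else _) = _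
  rw [dif_pos h, ws.injective h.choose_spec]

omit R t uz in
/-- The standard block off the point wires. [folklore] -/
theorem stdBlock_of_not_mem (ws : Fin Λ.ℓ ↪ Fin B) (hroom : Λ.base + I.n * B ≤ W) (i : Fin I.n) {q : Fin B}
    (hq : q ∉ Set.range ws) : (stdBlock I Λ hΛ ws hroom i q : ℕ) = Λ.base + ((i : ℕ) * B + q) := by
  have h : ¬ ∃ j, ws j = q := fun ⟨j, hj⟩ => hq ⟨j, hj⟩
  show ((if h : ∃ j, ws j = q then Λ.fin ((i : ℕ) * Λ.ℓ + h.choose) else ⟨Λ.base + ((i : ℕ) * B + q), _⟩ : Fin W) : ℕ) = _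
  rw [dif_neg h]

omit R t uz in
/-- **The standard blocks fit the layout.** [cite: Regev2009, Lemma 3.14 (proof: the registers)] [cite: NielsenChuang2010, §2.1.7] -/
theorem blocksFit_stdBlock (ws : Fin Λ.ℓ ↪ Fin B) (hroom : Λ.base + I.n * B ≤ W) :
    BlocksFit I Λ (stdBlock I Λ hΛ ws hroom) ws where
  disj i i' hii := by
    refine Set.disjoint_left.2 ?_
    rintro w ⟨q, rfl⟩ ⟨q', hq'⟩
    by_cases h : q ∈ Set.range ws <;> by_cases h' : q' ∈ Set.range ws
    · obtain ⟨j, rfl⟩ := h; obtain ⟨j', rfl⟩ := h'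
      rw [stdBlock_ws, stdBlock_ws] at hq'
      have hT := Λ.T_eq
      have h1 := blk_lt i j; have h2 := blk_lt i' j'
      exact hii (blk_inj (Layout.fin_inj hΛ (by omega) (by omega) hq'.symm)).1
    · obtain ⟨j, rfl⟩ := h
      have h1 := fin_blk_lt_base I hΛ i j
      rw [← stdBlock_ws I hΛ ws hroom i j, ← hq', stdBlock_of_not_mem I hΛ ws hroom i' h'] at h1
      omega
    · obtain ⟨j', rfl⟩ := h'
      have h1 := fin_blk_lt_base I hΛ i' j'
      rw [← stdBlock_ws I hΛ ws hroom i' j', hq', stdBlock_of_not_mem I hΛ ws hroom i h] at h1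
      omega
    · have e := congrArg Fin.val hq'
      rw [stdBlock_of_not_mem I hΛ ws hroom i h, stdBlock_of_not_mem I hΛ ws hroom i' h'] at e
      have e' : (i : ℕ) * B + q = (i' : ℕ) * B + q' := by omega
      exact hii (blk_inj e').1
  ws_eq i j := stdBlock_ws I hΛ ws hroom i j
  off_ge i q hq := by rw [stdBlock_of_not_mem I hΛ ws hroom i hq]; omega

/-! ### The prepared label is the block label -/

include hΛ in
/-- **The block label of the contents `Y` over the background `lab₀ x'` is the prepared label of the box
point `boxPt D Y`**, for blocks fitting the layout and a block base content clean off the point wires.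
[cite: Regev2009, Lemma 3.14 (proof), Lemma 3.12 (proof)] [cite: NielsenChuang2010, §2.1.7] -/
theorem boxLab_eq_lab₀ {E : Fin I.n → (Fin B ↪ Fin W)} {ws : Fin Λ.ℓ ↪ Fin B} (hE : BlocksFit I Λ E ws)
    (x₀ : QReg B) (hx₀ : ∀ q, q ∉ Set.range ws → x₀ q = false) (hD : DT I R t ≠ 0)
    (x' : EuclideanSpace ℝ (Fin I.n)) (Yb : Fin I.n → Fin Λ.ℓ → Bool) :
    boxLab E ws x₀ (lab₀ I Λ R t uz x') Yb = lab₀ I Λ R t uz (boxPt (DT I R t) Yb) := by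
  funext w
  by_cases hw : ∃ p : Fin I.n × Fin B, E p.1 p.2 = w
  · obtain ⟨⟨i, q⟩, rfl⟩ := hw
    rw [boxLab_apply_block ws x₀ _ hE.disj]
    by_cases hq : q ∈ Set.range ws
    · obtain ⟨j, rfl⟩ := hq
      rw [writeY_apply_ws, hE.ws_eq, lab₀_X I hΛ R t uz _ (blk_lt i j), blocksOf_boxPt I hD, getD_pointsWord]
    · rw [writeY_apply_of_not_mem ws x₀ _ hq, hx₀ q hq, lab₀_window I hΛ R t uz _ _ (hE.off_ge i q hq)]
  · have hoff : OffBlocks E w := fun i ⟨q, hq⟩ => hw ⟨(i, q), hq⟩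
    rw [boxLab_apply_off ws x₀ _ Yb hoff]
    refine lab₀_congr_off I R t uz x' _ w fun s hs h => ?_
    obtain ⟨i, j, hij⟩ := exists_block_of_lt I hE hs
    exact hw ⟨(i, ws j), (h.trans hij).symm⟩

include hΛ in
/-- **On the box, the block label map over the background `lab₀ x'` is the prepared-label map**: the two
embeddings of the box Gaussian coincide. [cite: Regev2009, Lemma 3.14 (proof), Lemma 3.12 (proof)] -/
theorem embed_boxLab₀_eq_embed_lab₀ {E : Fin I.n → (Fin B ↪ Fin W)} {ws : Fin Λ.ℓ ↪ Fin B} (hE : BlocksFit I Λ E ws)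
    (x₀ : QReg B) (hx₀ : ∀ q, q ∉ Set.range ws → x₀ q = false) (hD : DT I R t ≠ 0)
    (x' : EuclideanSpace ℝ (Fin I.n)) (a : EuclideanSpace ℝ (Fin I.n) → ℂ) :
    embed (boxSet I.n Λ.ℓ (DT I R t)) a (boxLab₀ E ws x₀ (lab₀ I Λ R t uz x') (DT I R t)) =
      embed (boxSet I.n Λ.ℓ (DT I R t)) a (lab₀ I Λ R t uz) := by
  unfold embed
  refine sum_congr rfl fun x hx => ?_
  unfold boxSet at hx
  obtain ⟨Yb, -, rfl⟩ := mem_image.1 hx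
  rw [boxLab₀_boxPt ws x₀ _ hD, boxLab_eq_lab₀ I hΛ R t uz hE x₀ hx₀ hD x' Yb]

include hΛ in
/-- **Regev 2009, Lemma 3.12 → Lemma 3.14 (machine form): the product of the point-Gaussian block states
over the background `lab₀ x'` is the box Gaussian on the prepared labels**,
`⨂ᵢ ptQsample = Z⁻¹ Σ_{x ∈ Box} ρ(x) |lab₀ x⟩` (`c = 2π/D²`, `D = D_g/t` the grid step in rescaled units).
This is the target state `Φ₀` of the Grover–Rudolph stage in `QPart.law_bound_of_basis`.
[cite: Regev2009, Lemma 3.12 (proof), Lemma 3.14 (proof)] [cite: NielsenChuang2010, §2.1.7] -/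
theorem prodState_ptQsample_eq_embed_lab₀ [IsZLattice ℝ I.lattice] [NeZero R] {E : Fin I.n → (Fin B ↪ Fin W)}
    {ws : Fin Λ.ℓ ↪ Fin B} (hE : BlocksFit I Λ E ws) (x₀ : QReg B) (hx₀ : ∀ q, q ∉ Set.range ws → x₀ q = false)
    {t : ℝ} (ht : 0 < t) (x' : EuclideanSpace ℝ (Fin I.n)) {c : ℝ} (hc : c = 2 * π / DT I R t ^ 2) :
    prodState E (fun _ => ptQsample Λ.ℓ c ws x₀) (lab₀ I Λ R t uz x') =
      embed (boxSet I.n Λ.ℓ (DT I R t)) (fun x => (((gaussianFunction 1 x / zBox (boxSet I.n Λ.ℓ (DT I R t)) : ℝ)) : ℂ))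
        (lab₀ I Λ R t uz) := by
  rw [prodState_ptQsample_eq_embed hE.disj ws x₀ _ (DT_pos I R ht) hc,
    embed_boxLab₀_eq_embed_lab₀ I hΛ R t uz hE x₀ hx₀ (DT_pos I R ht).ne' x']

/-! ### Erasing the block constants -/

section Erase

variable {V : Type*} {n b ℓ : ℕ}

omit I in
/-- **The layer of `NOT`s on the wires `L`**, compiled into Clifford+T. [cite: NielsenChuang2010, §3.2.5] -/
def notLayer (L : List (Fin W)) : QCircuit cliffordT W := ⟨revCompile (L.map RevOp.not)⟩

omit I in
/-- Flipping the wires of `L`. [folklore] -/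
def flipOn (L : List (Fin W)) (z : QReg W) : QReg W := fun q => if q ∈ L then !z q else z q

omit I in
/-- The `NOT` layer on distinct wires is the basis map `flipOn L`. [cite: NielsenChuang2010, §3.2.5] -/
theorem isBasisMap_notLayer (A : Language Bool) (L : List (Fin W)) (hL : L.Nodup) :
    IsBasisMap ((notLayer L).toMatrix A) (flipOn L) := fun z => by
  unfold notLayer
  rw [revCompile_mulVec_basisState, Lemma24.revEval_map_not L hL]
  rfl

omit I in
/-- The `NOT` layer is unitary. [folklore] -/
theorem notLayer_mem_unitaryGroup (A : Language Bool) (L : List (Fin W)) :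
    (notLayer L).toMatrix A ∈ Matrix.unitaryGroup (QReg W) ℂ :=
  QCircuit.toMatrix_mem_unitaryGroup_holds cliffordT_isUnitary_holds A _

omit I in
/-- **Erasing the block constants**: the flip on exactly the non-point block wires where the base contents
`x₀` and `x₁` differ turns the block label over `x₀` into the block label over `x₁`.
[cite: Regev2009, Lemma 3.14 (proof)] [cite: NielsenChuang2010, §3.2.5] -/
theorem flipOn_boxLab {E : Fin n → (Fin b ↪ Fin W)} (hE : BlockDisjoint E) (ws : Fin ℓ ↪ Fin b) (x₀ x₁ : QReg b)
    (cW : QReg W) (L : List (Fin W)) (hL : ∀ w, w ∈ L ↔ ∃ i q, q ∉ Set.range ws ∧ x₀ q ≠ x₁ q ∧ E i q = w)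
    (Y : Fin n → Fin ℓ → Bool) : flipOn L (boxLab E ws x₀ cW Y) = boxLab E ws x₁ cW Y := by
  funext w
  unfold flipOn
  by_cases hw : ∃ p : Fin n × Fin b, E p.1 p.2 = w
  · obtain ⟨⟨i, q⟩, rfl⟩ := hw
    rw [boxLab_apply_block ws x₀ cW hE, boxLab_apply_block ws x₁ cW hE]
    by_cases hq : q ∈ Set.range ws
    · obtain ⟨j, rfl⟩ := hq
      rw [writeY_apply_ws, writeY_apply_ws, if_neg]
      rintro hmem
      obtain ⟨i', q', hq', -, he⟩ := (hL _).1 hmem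
      obtain ⟨-, rfl⟩ := blocks_inj hE he
      exact hq' ⟨j, rfl⟩
    · rw [writeY_apply_of_not_mem ws x₀ _ hq, writeY_apply_of_not_mem ws x₁ _ hq]
      by_cases hne : x₀ q = x₁ q
      · rw [if_neg, hne]
        rintro hmem
        obtain ⟨i', q', -, hne', he⟩ := (hL _).1 hmem
        obtain ⟨-, rfl⟩ := blocks_inj hE he
        exact hne' hne
      · rw [if_pos ((hL _).2 ⟨i, q, hq, hne, rfl⟩)]
        revert hne
        cases x₀ q <;> cases x₁ q <;> simp
  · have hoff : OffBlocks E w := fun i ⟨q, hq⟩ => hw ⟨(i, q), hq⟩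
    rw [boxLab_apply_off ws x₀ cW Y hoff, boxLab_apply_off ws x₁ cW Y hoff, if_neg]
    rintro hmem
    obtain ⟨i', q', -, -, he⟩ := (hL _).1 hmem
    exact hw ⟨(i', q'), he⟩

omit I in
/-- The erasing layer relabels the box Gaussian over `x₀` into the box Gaussian over `x₁`.
[cite: Regev2009, Lemma 3.14 (proof)] [cite: NielsenChuang2010, §3.2.5] -/
theorem notLayer_mulVec_embed_boxLab₀ (A : Language Bool) {E : Fin n → (Fin b ↪ Fin W)} (hE : BlockDisjoint E)
    (ws : Fin ℓ ↪ Fin b) (x₀ x₁ : QReg b) (cW : QReg W) (L : List (Fin W)) (hLnd : L.Nodup)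
    (hL : ∀ w, w ∈ L ↔ ∃ i q, q ∉ Set.range ws ∧ x₀ q ≠ x₁ q ∧ E i q = w) {D : ℝ} (hD : D ≠ 0)
    (a : EuclideanSpace ℝ (Fin n) → ℂ) :
    (notLayer L).toMatrix A *ᵥ embed (boxSet n ℓ D) a (boxLab₀ E ws x₀ cW D) = embed (boxSet n ℓ D) a (boxLab₀ E ws x₁ cW D) := by
  rw [(isBasisMap_notLayer A L hLnd).mulVec_embed]
  unfold embed
  refine sum_congr rfl fun x hx => ?_
  unfold boxSet at hx
  obtain ⟨Yb, -, rfl⟩ := mem_image.1 hx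
  rw [Function.comp_apply, boxLab₀_boxPt ws x₀ _ hD, boxLab₀_boxPt ws x₁ _ hD, flipOn_boxLab hE ws x₀ x₁ cW L hL]

end Erase

/-! ### The Grover–Rudolph stage bound `ε₁` for the prepared labels -/

include hΛ in
/-- **Regev 2009, Lemma 3.14 — the Grover–Rudolph stage, `ε₁` (machine form).** Let the coordinate blocks
fit the layout, let the block's base content `x₀` lie in the block's promise set `D.P` (parameters and kit
constants in place), let `x₁` agree with `x₀` except on the non-point wires listed (through the blocks) in
`L`, where `x₁` is clean, and let the ideal one-block Grover–Rudolph product be `η`-close to the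
point-Gaussian state on `x₀`. Then from the clean label with the constants in place — the block label of
the contents `x₀ ∘ ws` over the background `lab₀ x'` — the stage circuit followed by the erasing layer is
within `n·(ℓ·grErr k + η)` of the box Gaussian on the prepared labels `embed Box (ρ/Z) lab₀`.
[cite: Regev2009, Lemma 3.14 (proof), Lemma 3.12 (proof)] [cite: NielsenChuang2010, Box 4.1, §3.2.5] [cite: GroverRudolph2002, eq. (1)] -/
theorem l2Norm_notLayer_grStage_sub_embed_le [IsZLattice ℝ I.lattice] [NeZero R] {kit : GadgetKit B}
    {ws : Fin Λ.ℓ ↪ Fin B} {np : ℕ} {pw : Fin np ↪ Fin B} {ag : Fin Λ.ℓ → (Fin Λ.ℓ → Bool) → ℝ}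
    (D : GRBlock.Data kit ws pw ag) {E : Fin I.n → (Fin B ↪ Fin W)} (hE : BlocksFit I Λ E ws)
    (x₀ : QReg B) (hx₀ : x₀ ∈ D.P) (x₁ : QReg B) (hx₁ : ∀ q, q ∉ Set.range ws → x₁ q = false)
    (L : List (Fin W)) (hLnd : L.Nodup) (hL : ∀ w, w ∈ L ↔ ∃ i q, q ∉ Set.range ws ∧ x₀ q ≠ x₁ q ∧ E i q = w)
    {t : ℝ} (ht : 0 < t) (x' : EuclideanSpace ℝ (Fin I.n)) {c : ℝ} (hc : c = 2 * π / DT I R t ^ 2)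
    (A : Language Bool) {η : ℝ}
    (hη : l2Norm ((List.ofFn fun j => genLevelGate ws (GRBlock.R ag) j).reverse.prod *ᵥ basisState x₀ - ptQsample Λ.ℓ c ws x₀) ≤ η) :
    l2Norm ((notLayer L).toMatrix A *ᵥ ((GRStage.stageCircuit D E).toMatrix 0 *ᵥ
          basisState (boxLab E ws x₀ (lab₀ I Λ R t uz x') fun _ => x₀ ∘ ws)) -
        embed (boxSet I.n Λ.ℓ (DT I R t)) (fun x => (((gaussianFunction 1 x / zBox (boxSet I.n Λ.ℓ (DT I R t)) : ℝ)) : ℂ))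
          (lab₀ I Λ R t uz)) ≤ I.n * (Λ.ℓ * grErr kit.k + η) := by
  set c₀ : QReg W := boxLab E ws x₀ (lab₀ I Λ R t uz x') fun _ => x₀ ∘ ws with hc₀
  have hblk : ∀ i, c₀ ∘ E i = x₀ := fun i => by rw [hc₀, boxLab_comp ws x₀ _ hE.disj, writeY_self]
  -- the stage on `|c₀⟩` is close to the product of the point-Gaussian states over `c₀`
  have h1 := GRStage.stage_output_sub_prodState_le D hE.disj c₀ (fun i => by rw [hblk i]; exact hx₀)
    (fun _ => ptQsample Λ.ℓ c ws x₀) (fun _ => (l2Norm_ptQsample Λ.ℓ c ws x₀).le) (η := fun _ => η)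
    (fun i => by rw [hblk i]; exact hη)
  rw [sum_const, card_univ, Fintype.card_fin, nsmul_eq_mul] at h1
  -- that product is the box Gaussian over `x₀`, and the erasing layer turns it into `embed Box (ρ/Z) lab₀`
  have h2 : prodState E (fun _ => ptQsample Λ.ℓ c ws x₀) c₀ =
      embed (boxSet I.n Λ.ℓ (DT I R t)) (fun x => (((gaussianFunction 1 x / zBox (boxSet I.n Λ.ℓ (DT I R t)) : ℝ)) : ℂ))
        (boxLab₀ E ws x₀ (lab₀ I Λ R t uz x') (DT I R t)) := by
    rw [prodState_congr_content E _ (c' := lab₀ I Λ R t uz x') fun w hw => by rw [hc₀, boxLab_apply_off ws x₀ _ _ hw],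
      prodState_ptQsample_eq_embed hE.disj ws x₀ _ (DT_pos I R ht) hc]
  have h3 : (notLayer L).toMatrix A *ᵥ prodState E (fun _ => ptQsample Λ.ℓ c ws x₀) c₀ =
      embed (boxSet I.n Λ.ℓ (DT I R t)) (fun x => (((gaussianFunction 1 x / zBox (boxSet I.n Λ.ℓ (DT I R t)) : ℝ)) : ℂ))
        (lab₀ I Λ R t uz) := by
    rw [h2, notLayer_mulVec_embed_boxLab₀ A hE.disj ws x₀ x₁ _ L hLnd hL (DT_pos I R ht).ne',
      embed_boxLab₀_eq_embed_lab₀ I hΛ R t uz hE x₁ hx₁ (DT_pos I R ht).ne' x']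
  rw [← h3, ← Matrix.mulVec_sub, l2Norm_mulVec_of_mem_unitaryGroup (notLayer_mem_unitaryGroup A L)]
  exact h1

include hΛ in
/-- **The Grover–Rudolph stage bound `ε₁` against the Gaussian qsample.** As
`l2Norm_notLayer_grStage_sub_embed_le`, with the one-block hypothesis split by the triangle inequality
into the distance `η_m` of the ideal Grover–Rudolph product to the Gaussian QSAMPLE `qsample (cellW ℓ c)`
(the machine's rounded angles, `GaussianCellsAngles`) and the tree's bound `2c(2·2^ℓ + 1)` between the
qsample and the point-Gaussian state (`GaussianCells.l2Norm_qsample_sub_ptQsample_le`):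
`ε₁ ≤ n·(ℓ·grErr k + η_m + 2c(2·2^ℓ + 1))`.
[cite: Regev2009, Lemma 3.14 (proof), Lemma 3.12 (proof)] [cite: GroverRudolph2002, eq. (1)] -/
theorem l2Norm_notLayer_grStage_sub_embed_le_of_qsample [IsZLattice ℝ I.lattice] [NeZero R] {kit : GadgetKit B}
    {ws : Fin Λ.ℓ ↪ Fin B} {np : ℕ} {pw : Fin np ↪ Fin B} {ag : Fin Λ.ℓ → (Fin Λ.ℓ → Bool) → ℝ}
    (D : GRBlock.Data kit ws pw ag) {E : Fin I.n → (Fin B ↪ Fin W)} (hE : BlocksFit I Λ E ws)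
    (x₀ : QReg B) (hx₀ : x₀ ∈ D.P) (x₁ : QReg B) (hx₁ : ∀ q, q ∉ Set.range ws → x₁ q = false)
    (L : List (Fin W)) (hLnd : L.Nodup) (hL : ∀ w, w ∈ L ↔ ∃ i q, q ∉ Set.range ws ∧ x₀ q ≠ x₁ q ∧ E i q = w)
    {t : ℝ} (ht : 0 < t) (x' : EuclideanSpace ℝ (Fin I.n)) {c : ℝ} (hc : c = 2 * π / DT I R t ^ 2)
    (hηc : c * (2 * 2 ^ Λ.ℓ + 1) ≤ 2) (A : Language Bool) {ηm : ℝ}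
    (hm : l2Norm ((List.ofFn fun j => genLevelGate ws (GRBlock.R ag) j).reverse.prod *ᵥ basisState x₀ - qsample (cellW Λ.ℓ c) ws x₀) ≤ ηm) :
    l2Norm ((notLayer L).toMatrix A *ᵥ ((GRStage.stageCircuit D E).toMatrix 0 *ᵥ
          basisState (boxLab E ws x₀ (lab₀ I Λ R t uz x') fun _ => x₀ ∘ ws)) -
        embed (boxSet I.n Λ.ℓ (DT I R t)) (fun x => (((gaussianFunction 1 x / zBox (boxSet I.n Λ.ℓ (DT I R t)) : ℝ)) : ℂ))
          (lab₀ I Λ R t uz)) ≤ I.n * (Λ.ℓ * grErr kit.k + (ηm + 2 * (c * (2 * 2 ^ Λ.ℓ + 1)))) := by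
  have hc0 : 0 ≤ c := by rw [hc]; positivity
  exact l2Norm_notLayer_grStage_sub_embed_le I hΛ R uz D hE x₀ hx₀ x₁ hx₁ L hLnd hL ht x' hc A
    ((l2Norm_sub_le _ _ _).trans (add_le_add hm (l2Norm_qsample_sub_ptQsample_le Λ.ℓ c hc0 hηc ws x₀)))

include hΛ in
/-- **The Grover–Rudolph stage bound `ε₁` with the machine's rounded angles (explicit form).** When the
block's angle function is the cosine machine's `A/2^{k_A}` (`GaussianCells.machineA` read off a
`δ`-accurate table of prefix masses with floor `μ ≥ 4δ`, `GaussianCellsAngles`) and the base content is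
clean on the point wires, `η_m ≤ ℓ·√(2ε² + 8·2^ℓ μ/W)` (`l2Norm_prod_machineBlock_sub_qsample_le`), so

  `ε₁ ≤ n·(ℓ·grErr k + ℓ·√(2ε² + 8·2^ℓ μ/W) + 2c(2·2^ℓ + 1))`, `ε = max(√(2ε₀), ε₀)`, `ε₀ = 2/2^{k_A} + √(3δ/μ)`,

`W = total (cellW ℓ c)`. [cite: Regev2009, Lemma 3.14 (proof), Lemma 3.12 (proof), §2 (p. 11)] [cite: GroverRudolph2002, eqs. (1)–(5)] -/
theorem l2Norm_notLayer_grStage_sub_embed_le_machine [IsZLattice ℝ I.lattice] [NeZero R] {kit : GadgetKit B}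
    {ws : Fin Λ.ℓ ↪ Fin B} {np : ℕ} {pw : Fin np ↪ Fin B} (kA : ℕ) (T : MassTable)
    (D : GRBlock.Data kit ws pw fun j y => (machineA kA T j y : ℝ) / 2 ^ kA) {E : Fin I.n → (Fin B ↪ Fin W)} (hE : BlocksFit I Λ E ws)
    (x₀ : QReg B) (hx₀ : x₀ ∈ D.P) (hx₀ws : ∀ j, x₀ (ws j) = false) (x₁ : QReg B) (hx₁ : ∀ q, q ∉ Set.range ws → x₁ q = false)
    (L : List (Fin W)) (hLnd : L.Nodup) (hL : ∀ w, w ∈ L ↔ ∃ i q, q ∉ Set.range ws ∧ x₀ q ≠ x₁ q ∧ E i q = w)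
    {t : ℝ} (ht : 0 < t) (x' : EuclideanSpace ℝ (Fin I.n)) {c : ℝ} (hc : c = 2 * π / DT I R t ^ 2)
    (hηc : c * (2 * 2 ^ Λ.ℓ + 1) ≤ 2) (A : Language Bool) {δ μ : ℝ} (hμ0 : 0 < μ) (hδ : 4 * δ ≤ μ) (hT : Accurate (ℓ := Λ.ℓ) c T δ) :
    l2Norm ((notLayer L).toMatrix A *ᵥ ((GRStage.stageCircuit D E).toMatrix 0 *ᵥ
          basisState (boxLab E ws x₀ (lab₀ I Λ R t uz x') fun _ => x₀ ∘ ws)) -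
        embed (boxSet I.n Λ.ℓ (DT I R t)) (fun x => (((gaussianFunction 1 x / zBox (boxSet I.n Λ.ℓ (DT I R t)) : ℝ)) : ℂ))
          (lab₀ I Λ R t uz)) ≤
      I.n * (Λ.ℓ * grErr kit.k +
        (Λ.ℓ * Real.sqrt (2 * (max (Real.sqrt (2 * (2 / 2 ^ kA + Real.sqrt (3 * δ / μ)))) (2 / 2 ^ kA + Real.sqrt (3 * δ / μ))) ^ 2 +
            8 * (2 ^ Λ.ℓ * μ / total (cellW Λ.ℓ c))) + 2 * (c * (2 * 2 ^ Λ.ℓ + 1)))) :=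
  l2Norm_notLayer_grStage_sub_embed_le_of_qsample I hΛ R uz D hE x₀ hx₀ x₁ hx₁ L hLnd hL ht x' hc hηc A
    (l2Norm_prod_machineBlock_sub_qsample_le c kA T ws hμ0 hδ hT x₀ hx₀ws)

end SamplerRegs

end Regev2009

end Literature.Computability.Cryptography

end
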